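import Mathlib
import Summits.QuantumFields.YangMills.Theorems.SpecificationCompactnessFibreIntegralInMeasure
import Summits.QuantumFields.YangMills.Theorems.SpecificationCompactnessCocycleNormalisation
import Literature.MathematicalPhysics.QuantumFieldTheory.Balaban1983to89.T3UnitLawDensityEML
import HarnessLib

/-!
# Route `SpecificationCompactness`, LINE 15 «cocycle_limit» (crux `SpecificationLimitAE`, stmt-QuantumFields-22688) — STUB B
# `stub_specificationFromCocycle`: THE BRIDGE from cocycle data to the specification limit (assembly of kernels 1 and 2)

`specificationFromCocycle` = the registered stub `stub_specificationFromCocycle` of the planner's skeleton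
(`lineK15-cocycle_limit/bc/SpecificationLimitAE_cocycle.lean`, ym-idea-5 g10) WITH ITS ABBREVIATIONS UNFOLDED (`pi0 = fieldMeasure`,
`haarG = HaarData.haar`, `ud = unitDensity`, `pK`, `R`, `envSigma`, `CocycleLimitAt`, `FibreUIAt`, `CruxBody`): for `(F, γ)`, a.e.-positivity
of `ρ̂_K` (stub D), the in-measure one-link cocycle limits `R_{K,e} → R_e > 0` (stub A) and fibre-UI in probability (stub C) give the crux body
with `q_e := (∫ max(R_e,0)(·,h) dh)⁻¹`.  Generic version first (`cruxBody_of_cocycle`, any finite product `⊗η`): (1) `p_{K,e} = I_{K,e}⁻¹` a.e.,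
`I_{K,e}(W) = ∫ R_{K,e}(W,h) dη` (fibre formula `condExp_pi_ae_eq_integral_update` and `u_K > 0`); (2) `I_{K,e} → I_e` in measure (kernel 1,
`tendstoInMeasure_fibreIntegral`); (3) inversion in measure by the subsequence criterion (`exists_seq_tendstoInMeasure_atTop_iff`, `I_e > 0` a.e.);
(4) normalisation and integrability from the cocycle (kernel 2, `condExp_invFibreIntegral_eq_one`).  Cell `ym-idea-1` width seat
`ym-line-sfw-p2-w3` gen 27 (free hands).  HONEST FRAMING: measure theory only; stubs A, C, D of the line stay hypotheses; rung R3 RECORD line;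
no crux, route, rung or mass gap is proved.  Sources: O. Kallenberg, *Foundations of Modern Probability* (2002), Thm 6.4 / Lemma 4.11.
-/

noncomputable section

namespace Summit.QuantumFields.YangMills.Theorems.SpecificationCompactnessSpecificationFromCocycle

open MeasureTheory Filter Topology Function Set
open scoped ENNReal
open Summit.QuantumFields.YangMills.Theorems.GibbsLimitUniqueness (condExp_pi_ae_eq_integral_update)
open Summit.QuantumFields.YangMills.Theorems.SpecificationCompactnessFibreIntegralInMeasure
  (ae_integrable_limit_fibre tendstoInMeasure_fibreIntegral)
open Summit.QuantumFields.YangMills.Theorems.SpecificationCompactnessCocycleNormalisation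
  (limit_cocycle_ae fibreIntegral_pos_ae condExp_invFibreIntegral_eq_one)

/-! ## §1 Generic: one link -/

section Product

variable {ι : Type*} [Fintype ι] [DecidableEq ι] {G : Type*} [MeasurableSpace G] (η : Measure G) [IsProbabilityMeasure η] (e : ι)

/-- **ONE LINK: from the cocycle data to the in-measure specification limit.**  On `(ι → G, ⊗η)`: `u_K ≥ 0` measurable integrable with `u_K > 0`
a.e.; `R_K(W,h) = u_K(W[e↦h])/u_K(W) → R_∞` in `(⊗η ⊗ η)`-measure with `R_∞ ≥ 0` measurable, `> 0` a.e.; fibre-UI in probability.  Then with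
`q := (∫ R_∞(·,h) dη)⁻¹`: `q` is measurable, `≥ 0`, `> 0` a.e., fibre-normalised `Π[q | links ≠ e] = 1` a.e., and the conditional densities
`u_K/Π[u_K | links ≠ e] → q` in measure. [cite: Kallenberg2002, Thm 6.4 and Lemma 4.11] -/
theorem specLimit_one_link (u : ℕ → (ι → G) → ℝ) (hum : ∀ K, Measurable (u K)) (hu0 : ∀ K W, 0 ≤ u K W)
    (hui : ∀ K, Integrable (u K) (Measure.pi fun _ : ι => η))
    (hupos : ∀ K, ∀ᵐ W ∂(Measure.pi fun _ : ι => η), 0 < u K W)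
    (Rinf : (ι → G) × G → ℝ) (hRim : Measurable Rinf) (hRi0 : ∀ z, 0 ≤ Rinf z)
    (hRpos : ∀ᵐ z ∂((Measure.pi fun _ : ι => η).prod η), 0 < Rinf z)
    (hlim : TendstoInMeasure ((Measure.pi fun _ : ι => η).prod η) (fun K z => u K (update z.1 e z.2) / u K z.1) atTop Rinf)
    (hUI : ∀ ε : ℝ, 0 < ε → ∃ (M : ℝ) (K₀ : ℕ), ∀ K, K₀ ≤ K →
      (Measure.pi fun _ : ι => η) {V | ENNReal.ofReal ε <
        ∫⁻ h, ENNReal.ofReal (u K (update V e h) / u K V - M) ∂η} ≤ ENNReal.ofReal ε) :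
    Measurable (fun W => (∫ a, Rinf (W, a) ∂η)⁻¹) ∧ (∀ W, 0 ≤ (∫ a, Rinf (W, a) ∂η)⁻¹) ∧
    (∀ᵐ W ∂(Measure.pi fun _ : ι => η), 0 < (∫ a, Rinf (W, a) ∂η)⁻¹) ∧
    (∀ᵐ W ∂(Measure.pi fun _ : ι => η),
      ((Measure.pi fun _ : ι => η)[fun W => (∫ a, Rinf (W, a) ∂η)⁻¹ |
        MeasurableSpace.comap (fun (W : ι → G) (b : {b // b ≠ e}) => W b.1) MeasurableSpace.pi]) W = 1) ∧
    TendstoInMeasure (Measure.pi fun _ : ι => η)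
      (fun K W => u K W / ((Measure.pi fun _ : ι => η)[u K |
        MeasurableSpace.comap (fun (W : ι → G) (b : {b // b ≠ e}) => W b.1) MeasurableSpace.pi]) W)
      atTop (fun W => (∫ a, Rinf (W, a) ∂η)⁻¹) := by
  set P : Measure (ι → G) := Measure.pi fun _ : ι => η with hP
  set R : ℕ → (ι → G) × G → ℝ := fun K z => u K (update z.1 e z.2) / u K z.1 with hR
  have hRm : ∀ K, Measurable (R K) := fun K => ((hum K).comp measurable_update').div ((hum K).comp measurable_fst)
  have hR0 : ∀ K z, 0 ≤ R K z := fun K z => div_nonneg (hu0 _ _) (hu0 _ _)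
  -- kernel 1: integrable limit fibres and fibre integrals in measure
  have hint : ∀ᵐ W ∂P, Integrable (fun h => Rinf (W, h)) η := ae_integrable_limit_fibre P η R hRm Rinf hRim hRi0 hlim hUI
  have hIlim : TendstoInMeasure P (fun K W => ∫ h, R K (W, h) ∂η) atTop (fun W => ∫ h, Rinf (W, h) ∂η) :=
    tendstoInMeasure_fibreIntegral P η R hRm hR0 Rinf hRim hRi0 hlim hUI
  -- kernel 2: positivity, normalisation, integrability
  have hcoc := limit_cocycle_ae η e u hupos Rinf hlim
  have hIpos : ∀ᵐ W ∂P, 0 < ∫ h, Rinf (W, h) ∂η := fibreIntegral_pos_ae η Rinf hRi0 hRpos hint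
  obtain ⟨-, -, hcond⟩ := condExp_invFibreIntegral_eq_one η e Rinf hRim hRi0 hRpos hcoc hint
  have hIm : Measurable fun W => ∫ a, Rinf (W, a) ∂η := (hRim.stronglyMeasurable.integral_prod_right' (ν := η)).measurable
  have hIKm : ∀ K, Measurable fun W => ∫ h, R K (W, h) ∂η := fun K =>
    ((hRm K).stronglyMeasurable.integral_prod_right' (ν := η)).measurable
  refine ⟨hIm.inv, fun W => inv_nonneg.mpr (integral_nonneg fun a => hRi0 _), hIpos.mono fun W hW => inv_pos.mpr hW, hcond, ?_⟩
  -- (3) inversion in measure by the subsequence criterion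
  have hinv : TendstoInMeasure P (fun K W => (∫ h, R K (W, h) ∂η)⁻¹) atTop (fun W => (∫ a, Rinf (W, a) ∂η)⁻¹) := by
    refine (exists_seq_tendstoInMeasure_atTop_iff (μ := P) (f := fun K W => (∫ h, R K (W, h) ∂η)⁻¹)
      (g := fun W => (∫ a, Rinf (W, a) ∂η)⁻¹) (fun K => (hIKm K).inv.aestronglyMeasurable)).mpr ?_
    intro ns hns
    obtain ⟨ns', hns', hae⟩ := (exists_seq_tendstoInMeasure_atTop_iff (fun K => (hIKm K).aestronglyMeasurable)).mp hIlim ns hns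
    refine ⟨ns', hns', ?_⟩
    filter_upwards [hae, hIpos] with W hW hWpos
    exact hW.inv₀ (ne_of_gt hWpos)
  -- (1) the conditional densities ARE the inverse fibre integrals, a.e.
  have hfibu : ∀ᵐ W ∂P, ∀ K, (P[u K | MeasurableSpace.comap (fun (W : ι → G) (b : {b // b ≠ e}) => W b.1) MeasurableSpace.pi]) W =
      ∫ a, u K (update W e a) ∂η := by
    rw [ae_all_iff]; intro K; exact condExp_pi_ae_eq_integral_update η e (hum K).stronglyMeasurable (hui K)
  have hposall : ∀ᵐ W ∂P, ∀ K, 0 < u K W := by rw [ae_all_iff]; exact hupos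
  refine hinv.congr_left (fun K => ?_)
  filter_upwards [hfibu, hposall] with W hW hWpos
  show (∫ h, R K (W, h) ∂η)⁻¹ = u K W / (P[u K | MeasurableSpace.comap (fun (W : ι → G) (b : {b // b ≠ e}) => W b.1) MeasurableSpace.pi]) W
  rw [hW K]
  show (∫ h, u K (update W e h) / u K W ∂η)⁻¹ = u K W / ∫ a, u K (update W e a) ∂η
  rw [integral_div, inv_div]

end Product

/-! ## §2 The registered stub in the route's vocabulary -/

section YM

open scoped Classical
open Literature.MathematicalPhysics.QuantumFieldTheory.Balaban1983to89
open Literature.MathematicalPhysics.QuantumFieldTheory.Balaban1983to89.T3ContinuumYM3Torus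
open Literature.MathematicalPhysics.QuantumFieldTheory.Balaban1983to89.T3UnitLawDensityEML

/-- **STUB B `stub_specificationFromCocycle` (abbreviations unfolded): from a.e.-positive renormalised unit densities, in-measure one-link
cocycle limits (a.e. positive) and fibre-UI in probability to the body of `SpecificationLimitAE` at `(F, γ)`, with
`q_e := (∫ max(R_e,0)(·,h) dh)⁻¹`. [cite: Kallenberg2002, Thm 6.4 and Lemma 4.11] -/
theorem specificationFromCocycle :
    ∀ (F : T3Family) (γ : ℝ), 0 < γ →
      (∀ K : ℕ, ∀ᵐ V ∂(fieldMeasure (F.P 0) 0 (Matrix.specialUnitaryGroup (Fin 2) ℂ)), 0 < unitDensity F γ K V) →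
      (∀ e : PBond (F.P 0) 0,
        ∃ Re : GaugeField (F.P 0) 0 (Matrix.specialUnitaryGroup (Fin 2) ℂ) × Matrix.specialUnitaryGroup (Fin 2) ℂ → ℝ,
          Measurable Re ∧
          (∀ᵐ z ∂((fieldMeasure (F.P 0) 0 (Matrix.specialUnitaryGroup (Fin 2) ℂ)).prod
            (HaarData.haar : Measure (Matrix.specialUnitaryGroup (Fin 2) ℂ))), 0 < Re z) ∧
          TendstoInMeasure ((fieldMeasure (F.P 0) 0 (Matrix.specialUnitaryGroup (Fin 2) ℂ)).prod
            (HaarData.haar : Measure (Matrix.specialUnitaryGroup (Fin 2) ℂ)))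
            (fun (K : ℕ) (z : GaugeField (F.P 0) 0 (Matrix.specialUnitaryGroup (Fin 2) ℂ) × Matrix.specialUnitaryGroup (Fin 2) ℂ) =>
              unitDensity F γ K (Function.update z.1 e z.2) / unitDensity F γ K z.1) atTop Re) →
      (∀ e : PBond (F.P 0) 0, ∀ ε : ℝ, 0 < ε → ∃ (M : ℝ) (K₀ : ℕ), ∀ K : ℕ, K₀ ≤ K →
        (fieldMeasure (F.P 0) 0 (Matrix.specialUnitaryGroup (Fin 2) ℂ))
          {V : GaugeField (F.P 0) 0 (Matrix.specialUnitaryGroup (Fin 2) ℂ) | ENNReal.ofReal ε <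
            ∫⁻ h, ENNReal.ofReal (unitDensity F γ K (Function.update V e h) / unitDensity F γ K V - M)
              ∂(HaarData.haar : Measure (Matrix.specialUnitaryGroup (Fin 2) ℂ))} ≤ ENNReal.ofReal ε) →
      ∃ q : PBond (F.P 0) 0 → GaugeField (F.P 0) 0 (Matrix.specialUnitaryGroup (Fin 2) ℂ) → ℝ,
        (∀ e, Measurable (q e)) ∧ (∀ e V, 0 ≤ q e V) ∧
        (∀ e, ∀ᵐ V ∂(fieldMeasure (F.P 0) 0 (Matrix.specialUnitaryGroup (Fin 2) ℂ)), 0 < q e V) ∧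
        (∀ e, ∀ᵐ V ∂(fieldMeasure (F.P 0) 0 (Matrix.specialUnitaryGroup (Fin 2) ℂ)),
          condExp (MeasurableSpace.comap (fun (W : GaugeField (F.P 0) 0 (Matrix.specialUnitaryGroup (Fin 2) ℂ))
            (b : {b : PBond (F.P 0) 0 // b ≠ e}) => W b.1) MeasurableSpace.pi)
            (fieldMeasure (F.P 0) 0 (Matrix.specialUnitaryGroup (Fin 2) ℂ)) (q e) V = 1) ∧
        ∀ e, TendstoInMeasure (fieldMeasure (F.P 0) 0 (Matrix.specialUnitaryGroup (Fin 2) ℂ))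
          (fun (K : ℕ) (V : GaugeField (F.P 0) 0 (Matrix.specialUnitaryGroup (Fin 2) ℂ)) =>
            unitDensity F γ K V /
              condExp (MeasurableSpace.comap (fun (W : GaugeField (F.P 0) 0 (Matrix.specialUnitaryGroup (Fin 2) ℂ))
                (b : {b : PBond (F.P 0) 0 // b ≠ e}) => W b.1) MeasurableSpace.pi)
                (fieldMeasure (F.P 0) 0 (Matrix.specialUnitaryGroup (Fin 2) ℂ)) (unitDensity F γ K) V)
          atTop (q e) := by
  intro F γ hγ hD hA hC
  haveI hηP : IsProbabilityMeasure (HaarData.haar : Measure (Matrix.specialUnitaryGroup (Fin 2) ℂ)) := HaarData.isProb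
  have hu := fun K => unitDensity_props F K hγ.le
  choose Re hRem hRepos hRelim using hA
  -- non-negative versions of the limits
  set Re' : PBond (F.P 0) 0 → GaugeField (F.P 0) 0 (Matrix.specialUnitaryGroup (Fin 2) ℂ) × Matrix.specialUnitaryGroup (Fin 2) ℂ → ℝ :=
    fun e z => max (Re e z) 0 with hRe'
  have main : ∀ e : PBond (F.P 0) 0, _ := fun e =>
    specLimit_one_link (HaarData.haar : Measure (Matrix.specialUnitaryGroup (Fin 2) ℂ)) e
      (fun K => unitDensity F γ K) (fun K => (hu K).1) (fun K => (hu K).2.1) (fun K => (hu K).2.2) hD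
      (Re' e) ((hRem e).max measurable_const) (fun z => le_max_right _ _)
      ((hRepos e).mono fun z hz => lt_max_of_lt_left hz)
      ((hRelim e).congr_right ((hRepos e).mono fun z hz => (max_eq_left hz.le).symm))
      (hC e)
  refine ⟨fun e V => (∫ a, Re' e (V, a) ∂(HaarData.haar : Measure (Matrix.specialUnitaryGroup (Fin 2) ℂ)))⁻¹,
    fun e => (main e).1, fun e => (main e).2.1, fun e => (main e).2.2.1, fun e => (main e).2.2.2.1, fun e => (main e).2.2.2.2⟩

end YM

end Summit.QuantumFields.YangMills.Theorems.SpecificationCompactnessSpecificationFromCocycle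

end
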